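import Literature.AnabelianGeometry.SemiGraphs.TemperedQuasiGeometricCompProofs
import Literature.AnabelianGeometry.SemiGraphs.TemperedMaximalCompactProofsAt
import HarnessLib

/-!
# [SemiAnbd] Def. 3.8 / Cor. 3.9: compatibly quasi-geometric homomorphisms compose — PER-GRAPH twin
# (cell ruling φ2 / α4-3 (iii))

Mochizuki, *Semi-graphs of anabelioids*, Publ. RIMS **42** (2006), §3, Def. 3.8 / Cor. 3.9 p. 268
[cite: MochizukiSemiAnbd2006, Cor 3.9 pp.42-43].  Companion of `TemperedQuasiGeometricCompProofs.lean`
(original untouched): the two declarations there that consume the ∀-graph named facts Thm. 3.7 (iv)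
`MaximalCompactIffVerticial` / (iii) `CompactInVerticial` are re-proved VERBATIM with the per-graph
predicates `MaximalCompactIffVerticialAt ℋ` / `CompactInVerticialAt ℋ` of
`TemperedCompactInVerticialAt.lean` (w4-d075) at the one graph `ℋ` where the original instantiates them (port
rule α4-3: `hX ℋ ↦ hX`, decl suffix `At`).  `IsQuasiGeometric.comp`, `IsCompatiblyQuasiGeometric.comp`
and the group theory need no twin.  Nothing here asserts Thm. 3.7 (iii) for countable `𝔾`; nothing
here takes a side on [IUTchIII] Cor. 3.12; typed ≠ discharged.
-/

namespace Literature.AnabelianGeometry.SemiGraphs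

universe u

namespace ProfiniteSemiGraph

variable {ℋ : ProfiniteSemiGraph.{u}}

/-- Per-graph twin of `infinite_inf_of_isMaximalCompactSubgroup`: under the hypotheses of Cor. 3.9 and
Thm. 3.7 (iv) AT `H`, a nontrivial intersection of two distinct maximal compact subgroups of
`π₁^temp(H)` is infinite. [cite: MochizukiSemiAnbd2006, Thm 3.7(iv) p.41] -/
theorem infinite_inf_of_isMaximalCompactSubgroupAt (h37iv : MaximalCompactIffVerticialAt ℋ)
    (hℋ : Cor39Hypotheses ℋ) (c : TemperedPiChart ℋ) (K H : Subgroup c.G)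
    (hK : IsMaximalCompactSubgroup K) (hH : IsMaximalCompactSubgroup H) (hne : K ≠ H)
    (hnt : K ⊓ H ≠ ⊥) : ((K ⊓ H : Subgroup c.G) : Set c.G).Infinite := by
  classical
  have hℋ37 := hℋ.thm37Hypotheses
  obtain ⟨-, hint⟩ := h37iv hℋ37 c
  choose ψ hψ using exists_isVerticialHom_of_thm37i verticialInjective_holds hℋ37 c
  obtain ⟨e, he, hL⟩ := (hint (K ⊓ H) hnt).mp ⟨K, H, hK, hH, hne, rfl⟩
  obtain ⟨b, -, v, -, -, q, -, hv, -⟩ := SemiGraph.exists_branches_of_isClosedEdge he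
  obtain ⟨g, hLg⟩ := edgeLike_eq_map_branchSubgroup c hv (q ▸ hL) (ψ v) (hψ v)
  haveI := infinite_branchSubgroup hℋ37.toProp36Hypotheses hv
  let f : ℋ.branchSubgroup b v hv → (K ⊓ H : Subgroup c.G) := fun x =>
    ⟨g * ψ v x.1 * g⁻¹, hLg ▸ ⟨ψ v x.1, ⟨x.1, x.2, rfl⟩, rfl⟩⟩
  have hf : Function.Injective f := by
    intro x y hxy
    have h1 : g * ψ v x.1 * g⁻¹ = g * ψ v y.1 * g⁻¹ := congrArg Subtype.val hxy
    have h2 : ψ v x.1 = ψ v y.1 := by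
      simpa [mul_left_cancel_iff, mul_right_cancel_iff] using h1
    exact Subtype.ext ((verticialInjective_holds ℋ hℋ37 c v).2 (ψ v) (hψ v) h2)
  haveI : Infinite (K ⊓ H : Subgroup c.G) := Infinite.of_injective f hf
  exact Set.infinite_coe_iff.mp ‹_›

/-- Per-graph twin of `IsCompatiblyQuasiGeometric.comp_of_maximalCompactIffVerticial`: compatibly
quasi-geometric homomorphisms through `π₁^temp(H)` compose, for `H` as in Cor. 3.9, given Thm. 3.7 (iv)
AT `H`. [cite: MochizukiSemiAnbd2006, Cor 3.9 pp.42-43] -/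
theorem _root_.Literature.AnabelianGeometry.SemiGraphs.IsCompatiblyQuasiGeometric.comp_of_maximalCompactIffVerticialAt
    (h37iv : MaximalCompactIffVerticialAt ℋ) (hℋ : Cor39Hypotheses ℋ) (c : TemperedPiChart ℋ)
    {G₁ : Type u} [Group G₁] [TopologicalSpace G₁] {G₃ : Type u} [Group G₃] [TopologicalSpace G₃]
    [IsTopologicalGroup G₃] [T2Space G₃] {φ₁ : G₁ →ₜ* c.G} {φ₂ : c.G →ₜ* G₃}
    (h₁ : IsCompatiblyQuasiGeometric φ₁) (h₂ : IsCompatiblyQuasiGeometric φ₂) :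
    IsCompatiblyQuasiGeometric (φ₂.comp φ₁) := by
  haveI := TemperedPiChart.t2Space c
  exact h₁.comp (infinite_inf_of_isMaximalCompactSubgroupAt h37iv hℋ c) h₂

/-- Per-graph twin of `IsCompatiblyQuasiGeometric.comp_of_compactInVerticial`: the same given Thm. 3.7
(iii) AT `H` alone (d075's `maximalCompactIffVerticialAt_of_thm37` with Thm. 3.7 (i), (ii) bound to
`verticialInjective_holds`, `verticialDistinct_holds`). [cite: MochizukiSemiAnbd2006, Cor 3.9 pp.42-43] -/
theorem _root_.Literature.AnabelianGeometry.SemiGraphs.IsCompatiblyQuasiGeometric.comp_of_compactInVerticialAt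
    (h37iii : CompactInVerticialAt ℋ) (hℋ : Cor39Hypotheses ℋ) (c : TemperedPiChart ℋ)
    {G₁ : Type u} [Group G₁] [TopologicalSpace G₁] {G₃ : Type u} [Group G₃] [TopologicalSpace G₃]
    [IsTopologicalGroup G₃] [T2Space G₃] {φ₁ : G₁ →ₜ* c.G} {φ₂ : c.G →ₜ* G₃}
    (h₁ : IsCompatiblyQuasiGeometric φ₁) (h₂ : IsCompatiblyQuasiGeometric φ₂) :
    IsCompatiblyQuasiGeometric (φ₂.comp φ₁) :=
  h₁.comp_of_maximalCompactIffVerticialAt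
    (maximalCompactIffVerticialAt_of_thm37 h37iii verticialDistinct_holds verticialInjective_holds) hℋ c h₂

end ProfiniteSemiGraph

end Literature.AnabelianGeometry.SemiGraphs
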